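import Literature.Geometry.Lorentzian.CoordWeightedVectorEstimates
import Literature.Geometry.Lorentzian.CoordFormVectorCauchySchwarz
import HarnessLib

/-!
# The weighted Poincaré inequality for vector fields (Chruściel–Delay 2003, App. C, Prop. C.2)

Topic `Literature/Geometry/Lorentzian`, coordinate tensor calculus `MetricCoord` (Riemannian metric
components `G` on an open set `V`). Everything here is PROVED; no definition and no statement of
`Prop` type is introduced.

`CoordWeightedPoincare.lean` proves Prop. C.2 of Chruściel–Delay (Mém. SMF 94 (2003)) for
functions; the printed statement is for tensor fields `u`, with `|u|²` and `|∇u|²` the metric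
square norms. Here is the case of a vector field `U` (the case needed for `u = x²∇N` in the proof
of Thm. 5.9, p. 29), with `|∇U|²_G = tr_G G(∇·U, ∇·U)`
(`mtrAt G y ((G y).bilinearComp (covDAt G U y) (covDAt G U y))`):

* `IsMetricOn.mtrAt_bilinearComp_nonneg` — `tr_G G(L·, L·) = Σ_c |L e_c|² ≥ 0`;
* `IsMetricOn.mtrAt_bilinearComp_add_smulRight` —
  `tr_G G((L + θ⊗u)·, (L + θ⊗u)·) = tr_G G(L·,L·) + 2 G(L ♯θ, u) + |θ|² |u|²`;
* `IsMetricOn.weightedPoincareVector_pointwise` — the Green identity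
  `e^{2v}|∇U|² − e^{2v}(Δv + Δw + |∇v|² − |∇w|²)|U|² = e^{2v}|∇U + d(v+w) ⊗ U|² + div B`,
  `B = −|U|² e^{2v} ∇(v+w)`;
* **`IsMetricOn.integral_weightedPoincareVector`** — **Prop. C.2 for vector fields**:
  `∫ √det g · e^{2v}(Δv + Δw + |∇v|² − |∇w|²)|U|² dμ ≤ ∫ √det g · e^{2v}|∇U|² dμ`
  for `U` smooth on `V` with compact support inside `V`.

## References

* P. T. Chruściel, E. Delay, Mém. Soc. Math. Fr. 94 (2003), App. C, Prop. C.2.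
  [ChruscielDelay2003]
* B. O'Neill, *Semi-Riemannian geometry*, 1983, Ch. 2, Lemma 2.25; Ch. 3, Prop. 3.13.
  [ONeill1983]
-/

noncomputable section

set_option maxSynthPendingDepth 3

open Set Filter Module Function MeasureTheory
open scoped Topology ContDiff

namespace Literature.Geometry.Lorentzian

namespace MetricCoord

variable {E : Type*} [NormedAddCommGroup E] [NormedSpace ℝ E] [FiniteDimensional ℝ E]
  [CompleteSpace E] {ι : Type*} [Fintype ι] [DecidableEq ι] (b : Basis ι ℝ E)
  {G : E → E →L[ℝ] E →L[ℝ] ℝ} {V : Set E} {x : E} {U : E → E} {v w : E → ℝ}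

/-! ### The trace of `G(L·, L·)` -/

omit [CompleteSpace E] [Fintype ι] [DecidableEq ι] in
/-- **`tr_G G(L·, L·) ≥ 0`** at a positive definite point (`= Σ_c G(L e_c, L e_c)` in an
orthonormal frame). [cite: ONeill1983, Ch. 2, Lemma 2.25] -/
theorem IsMetricOn.mtrAt_bilinearComp_nonneg (hG : IsMetricOn G V) (hx : x ∈ V)
    (hpos : ∀ e : E, e ≠ 0 → 0 < G x e e) (L : E →L[ℝ] E) :
    0 ≤ mtrAt G x ((G x).bilinearComp L L) := by
  have hi := hG.isInvertible x hx
  obtain ⟨e, he⟩ := exists_orthonormal_basis (hG.symm x hx) hpos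
  rw [mtrAt_eq_sum_frame e he hi]
  refine Finset.sum_nonneg fun c _ ↦ ?_
  rw [ContinuousLinearMap.bilinearComp_apply]
  by_cases h0 : L (e c) = 0
  · simp [h0]
  · exact (hpos _ h0).le

omit [CompleteSpace E] [Fintype ι] [DecidableEq ι] in
/-- **`tr_G G((L + θ⊗u)·, (L + θ⊗u)·) = tr_G G(L·, L·) + 2 G(L ♯θ, u) + θ(♯θ) G(u,u)`** at a
symmetric positive definite point (`♯θ = Σ_c θ(e_c) e_c`, `θ(♯θ) = Σ_c θ(e_c)²` in an orthonormal
frame). [cite: ONeill1983, Ch. 2, Lemma 2.25] -/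
theorem IsMetricOn.mtrAt_bilinearComp_add_smulRight (hG : IsMetricOn G V) (hx : x ∈ V)
    (hpos : ∀ e : E, e ≠ 0 → 0 < G x e e) (L : E →L[ℝ] E) (θ : E →L[ℝ] ℝ) (u : E) :
    mtrAt G x ((G x).bilinearComp (L + θ.smulRight u) (L + θ.smulRight u)) =
      mtrAt G x ((G x).bilinearComp L L) + 2 * G x (L (sharpAt G x θ)) u
        + θ (sharpAt G x θ) * G x u u := by
  have hi := hG.isInvertible x hx
  have hs := hG.symm x hx
  obtain ⟨e, he⟩ := exists_orthonormal_basis hs hpos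
  rw [mtrAt_eq_sum_frame e he hi, mtrAt_eq_sum_frame e he hi]
  have h1 : G x (L (sharpAt G x θ)) u = ∑ c, θ (e c) * G x (L (e c)) u := by
    rw [sharpAt_eq_sum_frame e he hi hs θ, map_sum, map_sum, _root_.sum_apply]
    refine Finset.sum_congr rfl fun c _ ↦ ?_
    rw [map_smul, map_smul, _root_.smul_apply, smul_eq_mul]
  have h2 : θ (sharpAt G x θ) = ∑ c, θ (e c) * θ (e c) := apply_sharpAt_eq_sum_frame e he hi hs θ θ
  rw [h1, h2, Finset.mul_sum, Finset.sum_mul, ← Finset.sum_add_distrib, ← Finset.sum_add_distrib]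
  refine Finset.sum_congr rfl fun c _ ↦ ?_
  simp only [ContinuousLinearMap.bilinearComp_apply, _root_.add_apply,
    ContinuousLinearMap.smulRight_apply, map_add, map_smul, _root_.smul_apply,
    smul_eq_mul, hs u (L (e c))]
  ring

/-! ### The pointwise identity -/

omit [FiniteDimensional ℝ E] [CompleteSpace E] in
/-- For symmetric invertible `G x`: `α(♯β) = β(♯α)`. [folklore] -/
private theorem apply_sharpAt_comm_vec (hx : (G x).IsInvertible) (hs : ∀ v w : E, G x v w = G x w v)
    (α β : E →L[ℝ] ℝ) : α (sharpAt G x β) = β (sharpAt G x α) := by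
  rw [← apply_sharpAt_apply hx α (sharpAt G x β), hs, apply_sharpAt_apply hx]

omit [Fintype ι] [DecidableEq ι] in
/-- **The Green identity behind Prop. C.2 for vector fields**: for `U` and `v, w` smooth on `V`
and `x ∈ V` (with `G x` positive definite),
`e^{2v}|∇U|² − e^{2v}(Δv + Δw + |∇v|² − |∇w|²)|U|² = e^{2v}|∇U + d(v+w)⊗U|² + div_G B`,
`B = −|U|² e^{2v} ∇(v+w)` (`d|U|²(X) = 2G(∇_X U, U)`, `div(ψZ) = ψ div Z + dψ(Z)`, `div ∇φ = Δφ`).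
[cite: ChruscielDelay2003, App. C, Prop. C.2] -/
theorem IsMetricOn.weightedPoincareVector_pointwise (hG : IsMetricOn G V) (hx : x ∈ V)
    (hpos : ∀ e : E, e ≠ 0 → 0 < G x e e)
    (hU : ContDiffOn ℝ ∞ U V) (hv : ContDiffOn ℝ ∞ v V) (hw : ContDiffOn ℝ ∞ w V) :
    Real.exp (2 * v x) * mtrAt G x ((G x).bilinearComp (covDAt G U x) (covDAt G U x))
      - Real.exp (2 * v x) * (lapAt G v x + lapAt G w x + gradSqAt G v x - gradSqAt G w x)
        * G x (U x) (U x) =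
      Real.exp (2 * v x) * mtrAt G x ((G x).bilinearComp
          (covDAt G U x + (fderiv ℝ (fun y ↦ v y + w y) x).smulRight (U x))
          (covDAt G U x + (fderiv ℝ (fun y ↦ v y + w y) x).smulRight (U x)))
        + divAt G (fun y ↦ (-(G y (U y) (U y) * Real.exp (2 * v y))) •
            sharpAt G y (fderiv ℝ (fun z ↦ v z + w z) y)) x := by
  have hi := hG.isInvertible x hx
  have hs := hG.symm x hx
  have hxs : V ∈ 𝓝 x := hG.mem_nhds hx
  have hφ : ContDiffOn ℝ ∞ (fun y ↦ v y + w y) V := hv.add hw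
  have hUd : DifferentiableAt ℝ U x := ((hU x hx).contDiffAt hxs).differentiableAt (by simp)
  have hvd : DifferentiableAt ℝ v x := ((hv x hx).contDiffAt hxs).differentiableAt (by simp)
  have hwd : DifferentiableAt ℝ w x := ((hw x hx).contDiffAt hxs).differentiableAt (by simp)
  have hv2 : ContDiffAt ℝ 2 v x := contDiffAt_two_of_contDiffOn hG.isOpen hv hx
  have hw2 : ContDiffAt ℝ 2 w x := contDiffAt_two_of_contDiffOn hG.isOpen hw hx
  have hZs : ContDiffOn ℝ ∞ (fun y ↦ sharpAt G y (fderiv ℝ (fun z ↦ v z + w z) y)) V :=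
    hG.contDiffOn_sharpAt.clm_apply (hφ.fderiv_of_isOpen hG.isOpen (by simp))
  have hZd : DifferentiableAt ℝ (fun y ↦ sharpAt G y (fderiv ℝ (fun z ↦ v z + w z) y)) x :=
    ((hZs x hx).contDiffAt hxs).differentiableAt (by simp)
  -- `|U|²` and its differential
  have hnUs : ContDiffOn ℝ ∞ (fun y ↦ G y (U y) (U y)) V := (hG.contDiffOn.clm_apply hU).clm_apply hU
  have hnUd : DifferentiableAt ℝ (fun y ↦ G y (U y) (U y)) x :=
    ((hnUs x hx).contDiffAt hxs).differentiableAt (by simp)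
  have hdnU : ∀ Z, fderiv ℝ (fun y ↦ G y (U y) (U y)) x Z = 2 * G x (covDAt G U x Z) (U x) := by
    intro Z
    rw [hG.fderiv_metric_pairing hx hUd hUd Z, hs (U x), two_mul]
  -- the weight `ψ = −|U|² e^{2v}` and its differential
  have hψ : HasFDerivAt (fun y ↦ -(G y (U y) (U y) * Real.exp (2 * v y)))
      (-((G x (U x) (U x)) • (Real.exp (2 * v x) • ((2 : ℝ) • fderiv ℝ v x))
        + Real.exp (2 * v x) • fderiv ℝ (fun y ↦ G y (U y) (U y)) x)) x := by
    have h2 : HasFDerivAt (fun y ↦ Real.exp (2 * v y))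
        (Real.exp (2 * v x) • ((2 : ℝ) • fderiv ℝ v x)) x :=
      (hvd.hasFDerivAt.const_mul (2 : ℝ)).exp
    exact (hnUd.hasFDerivAt.mul h2).neg
  have hψd : DifferentiableAt ℝ (fun y ↦ -(G y (U y) (U y) * Real.exp (2 * v y))) x :=
    hψ.differentiableAt
  -- the divergence of `B = ψ • ♯d(v+w)` and the expansion of `|∇U + dφ ⊗ U|²`
  rw [divAt_smul hψd hZd, hG.divAt_sharpAt_fderiv hx hφ, lapAt_add G hv2 hw2, hψ.fderiv,
    hG.mtrAt_bilinearComp_add_smulRight hx hpos, fderiv_fun_add hvd hwd]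
  set dv := fderiv ℝ v x with hdv
  set dw := fderiv ℝ w x with hdw
  have evw : dv (sharpAt G x dw) = dw (sharpAt G x dv) := apply_sharpAt_comm_vec hi hs dv dw
  simp only [gradSqAt_apply, map_add, _root_.add_apply, FunLike.coe_smul,
    Pi.smul_apply, _root_.neg_apply, smul_eq_mul, ← hdv, ← hdw, hdnU]
  rw [evw]
  ring

/-! ### Prop. C.2 for vector fields -/

section Integral

variable [MeasurableSpace E] [BorelSpace E] (μ : Measure E) [μ.IsAddHaarMeasure]

/-- **Weighted Poincaré inequality for vector fields** (Chruściel–Delay 2003, App. C, Prop. C.2):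
for Riemannian metric components `G` on `V`, a vector field `U` smooth on `V` with compact
support inside `V` and `v, w` smooth on `V`,
`∫ √det g · e^{2v}(Δv + Δw + |∇v|² − |∇w|²)|U|²_G dμ ≤ ∫ √det g · e^{2v}|∇U|²_G dμ`,
`|∇U|²_G = tr_G G(∇·U, ∇·U)`. Proof as printed: `0 ≤ ∫ e^{2v}|∇U + U ⊗ ∇(v+w)|²` and an
integration by parts (`weightedPoincareVector_pointwise`,
`IsMetricOn.integral_sqrtDetGram_mul_eq_of_eq_add_divAt`).
[cite: ChruscielDelay2003, App. C, Prop. C.2] -/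
theorem IsMetricOn.integral_weightedPoincareVector (hG : IsMetricOn G V)
    (hpos : ∀ y ∈ V, ∀ e : E, e ≠ 0 → 0 < G y e e)
    (hU : ContDiffOn ℝ ∞ U V) (hsupp : HasCompactSupport U) (hUV : tsupport U ⊆ V)
    (hv : ContDiffOn ℝ ∞ v V) (hw : ContDiffOn ℝ ∞ w V) :
    ∫ y, sqrtDetGram G b y * (Real.exp (2 * v y)
        * (lapAt G v y + lapAt G w y + gradSqAt G v y - gradSqAt G w y) * G y (U y) (U y)) ∂μ ≤
      ∫ y, sqrtDetGram G b y * (Real.exp (2 * v y)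
        * mtrAt G y ((G y).bilinearComp (covDAt G U y) (covDAt G U y))) ∂μ := by
  -- notation
  set φ : E → ℝ := fun y ↦ v y + w y with hφdef
  have hφ : ContDiffOn ℝ ∞ φ V := hv.add hw
  set L : E → E →L[ℝ] E := fun y ↦ covDAt G U y + (fderiv ℝ φ y).smulRight (U y) with hLdef
  set h : E → ℝ := fun y ↦ Real.exp (2 * v y) * mtrAt G y ((G y).bilinearComp (L y) (L y))
    with hhdef
  set f₁ : E → ℝ := fun y ↦ Real.exp (2 * v y)
      * mtrAt G y ((G y).bilinearComp (covDAt G U y) (covDAt G U y)) with hf₁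
  set f₂ : E → ℝ := fun y ↦ Real.exp (2 * v y)
      * (lapAt G v y + lapAt G w y + gradSqAt G v y - gradSqAt G w y) * G y (U y) (U y) with hf₂
  set B : E → E := fun y ↦ (-(G y (U y) (U y) * Real.exp (2 * v y))) •
      sharpAt G y (fderiv ℝ φ y) with hBdef
  -- `U` vanishes to first order off its support
  have hU0 : ∀ y ∉ tsupport U, ∀ᶠ z in 𝓝 y, U z = 0 ∧ fderiv ℝ U z = 0 := by
    intro y hy
    have hyu : U =ᶠ[𝓝 y] fun _ ↦ 0 := notMem_tsupport_iff_eventuallyEq.mp hy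
    obtain ⟨W, hW, hWo, hyW⟩ := mem_nhds_iff.1 hyu
    filter_upwards [hWo.mem_nhds hyW] with z hz
    have hzu : U =ᶠ[𝓝 z] fun _ ↦ 0 :=
      Filter.eventually_of_mem (hWo.mem_nhds hz) fun t ht ↦ hW ht
    exact ⟨hzu.self_of_nhds, by rw [hzu.fderiv_eq, fderiv_fun_const]; rfl⟩
  have hcov0 : ∀ z, U z = 0 → fderiv ℝ U z = 0 → covDAt G U z = 0 := fun z h0 h1 ↦ by
    ext e; simp only [covDAt_apply, h0, h1, map_zero, _root_.zero_apply, add_zero]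
  have hL0 : ∀ z, U z = 0 → fderiv ℝ U z = 0 → L z = 0 := fun z h0 h1 ↦ by
    simp only [hLdef, hcov0 z h0 h1, h0, ContinuousLinearMap.smulRight_zero, add_zero]
  have hmtr0 : ∀ z, mtrAt G z ((G z).bilinearComp (0 : E →L[ℝ] E) (0 : E →L[ℝ] E)) = 0 :=
    fun z ↦ by rw [mtrAt_eq_sum b]; simp
  -- smoothness on `V`
  have htr : ∀ {A : E → E →L[ℝ] E}, ContDiffOn ℝ ∞ A V →
      ContDiffOn ℝ ∞ (fun y ↦ mtrAt G y ((G y).bilinearComp (A y) (A y))) V := by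
    intro A hA
    have heq : (fun y ↦ mtrAt G y ((G y).bilinearComp (A y) (A y))) =
        fun y ↦ ∑ i, ∑ j, ginv G b y i j * G y (A y (b i)) (A y (b j)) := by
      funext y
      rw [mtrAt_eq_sum b]
      simp only [ContinuousLinearMap.bilinearComp_apply]
    rw [heq]
    refine ContDiffOn.sum fun i _ ↦ ContDiffOn.sum fun j _ ↦ ?_
    exact (hG.contDiffOn_ginv b i j).mul
      ((hG.contDiffOn.clm_apply (hA.clm_apply contDiffOn_const)).clm_apply
        (hA.clm_apply contDiffOn_const))
  have hnUs : ContDiffOn ℝ ∞ (fun y ↦ G y (U y) (U y)) V := (hG.contDiffOn.clm_apply hU).clm_apply hU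
  have hdφ : ContDiffOn ℝ ∞ (fun y ↦ fderiv ℝ φ y) V := hφ.fderiv_of_isOpen hG.isOpen (by simp)
  have hLs : ContDiffOn ℝ ∞ L V := (hG.contDiffOn_covDAt hU).add (hdφ.smulRight hU)
  have hBs : ContDiffOn ℝ ∞ B V :=
    (hnUs.mul (contDiffOn_const.mul hv).exp).neg.smul (hG.contDiffOn_sharpAt.clm_apply hdφ)
  have hBsupp : HasCompactSupport B := by
    refine hsupp.mono' fun y hy ↦ ?_
    by_contra hyu
    exact hy (by simp [hBdef, (hU0 y hyu).self_of_nhds.1])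
  have hBV : tsupport B ⊆ V := by
    refine (closure_minimal (fun y hy ↦ ?_) (isClosed_tsupport U)).trans hUV
    by_contra hyu
    exact hy (by simp [hBdef, (hU0 y hyu).self_of_nhds.1])
  have hhs : ContDiffOn ℝ ∞ h V := (contDiffOn_const.mul hv).exp.mul (htr hLs)
  have hf₁s : ContDiffOn ℝ ∞ f₁ V := (contDiffOn_const.mul hv).exp.mul (htr (hG.contDiffOn_covDAt hU))
  have hf₂s : ContDiffOn ℝ ∞ f₂ V :=
    (((contDiffOn_const.mul hv).exp.mul ((((hG.contDiffOn_lapAt hv).add (hG.contDiffOn_lapAt hw)).add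
      (hG.contDiffOn_gradSqAt hv)).sub (hG.contDiffOn_gradSqAt hw))).mul hnUs)
  have hsg : ContDiffOn ℝ ∞ (sqrtDetGram G b) V := hG.contDiffOn_sqrtDetGram b hpos
  have cont : ∀ {k : E → ℝ}, ContDiffOn ℝ ∞ k V → ∀ y ∈ V,
      ContinuousAt (fun z ↦ sqrtDetGram G b z * k z) y := fun hk y hy ↦
    ((hsg.continuousOn.continuousWithinAt hy).continuousAt (hG.mem_nhds hy)).mul
      ((hk.continuousOn.continuousWithinAt hy).continuousAt (hG.mem_nhds hy))
  -- integrability of the three integrands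
  have hI : ∀ {k : E → ℝ}, ContDiffOn ℝ ∞ k V →
      (∀ z, U z = 0 → fderiv ℝ U z = 0 → k z = 0) →
      Integrable (fun z ↦ sqrtDetGram G b z * k z) μ := by
    intro k hk hk0
    have hc : Continuous fun z ↦ sqrtDetGram G b z * k z := by
      refine continuous_iff_continuousAt.2 fun y ↦ ?_
      by_cases hy : y ∈ tsupport U
      · exact cont hk y (hUV hy)
      · have hev : (fun z ↦ sqrtDetGram G b z * k z) =ᶠ[𝓝 y] fun _ ↦ 0 :=
          (hU0 y hy).mono fun z hz ↦ by simp only [hk0 z hz.1 hz.2, mul_zero]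
        exact (continuousAt_const.congr_of_eventuallyEq hev :)
    refine hc.integrable_of_hasCompactSupport (hsupp.mono' fun y hy ↦ ?_)
    by_contra hyU
    have h0 := (hU0 y hyU).self_of_nhds
    exact hy (show sqrtDetGram G b y * k y = 0 by rw [hk0 y h0.1 h0.2, mul_zero])
  have hf₁0 : ∀ z, U z = 0 → fderiv ℝ U z = 0 → f₁ z = 0 := fun z h0 h1 ↦ by
    simp only [hf₁, hcov0 z h0 h1, hmtr0, mul_zero]
  have hf₂0 : ∀ z, U z = 0 → fderiv ℝ U z = 0 → f₂ z = 0 := fun z h0 _ ↦ by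
    simp only [hf₂, h0, map_zero, mul_zero]
  have hh0 : ∀ z, U z = 0 → fderiv ℝ U z = 0 → h z = 0 := fun z h0 h1 ↦ by
    simp only [hhdef, hL0 z h0 h1, hmtr0, mul_zero]
  have hI₁ := hI hf₁s hf₁0
  have hI₂ := hI hf₂s hf₂0
  have hIh := hI hhs hh0
  -- off `V` everything vanishes
  have hoff : ∀ y ∉ V, U y = 0 ∧ fderiv ℝ U y = 0 := fun y hy ↦
    (hU0 y fun h' ↦ hy (hUV h')).self_of_nhds
  -- the Green identity, integrated
  have hGreen : ∫ y, sqrtDetGram G b y * (f₁ y - f₂ y) ∂μ = ∫ y, sqrtDetGram G b y * h y ∂μ := by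
    refine hG.integral_sqrtDetGram_mul_eq_of_eq_add_divAt b μ hpos hBs hBsupp hBV
      (fun y hy ↦ ?_) (fun y hy ↦ ?_) (fun y hy ↦ ?_) hIh
    · exact hG.weightedPoincareVector_pointwise hy (hpos y hy) hU hv hw
    · rw [hf₁0 y (hoff y hy).1 (hoff y hy).2, hf₂0 y (hoff y hy).1 (hoff y hy).2, sub_zero]
    · exact hh0 y (hoff y hy).1 (hoff y hy).2
  -- positivity of the right-hand side
  have hpos' : 0 ≤ ∫ y, sqrtDetGram G b y * h y ∂μ := by
    refine integral_nonneg fun y ↦ ?_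
    show 0 ≤ sqrtDetGram G b y * h y
    by_cases hy : y ∈ V
    · exact mul_nonneg (Real.sqrt_nonneg _) (mul_nonneg (Real.exp_nonneg _)
        (hG.mtrAt_bilinearComp_nonneg hy (hpos y hy) (L y)))
    · rw [hh0 y (hoff y hy).1 (hoff y hy).2, mul_zero]
  have hsplit : ∫ y, sqrtDetGram G b y * (f₁ y - f₂ y) ∂μ =
      (∫ y, sqrtDetGram G b y * f₁ y ∂μ) - ∫ y, sqrtDetGram G b y * f₂ y ∂μ := by
    simp_rw [mul_sub]
    exact integral_sub hI₁ hI₂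
  have key : (∫ y, sqrtDetGram G b y * f₂ y ∂μ) ≤ ∫ y, sqrtDetGram G b y * f₁ y ∂μ := by
    linarith [hGreen, hsplit, hpos']
  simpa only [hf₁, hf₂] using key

end Integral

end MetricCoord

end Literature.Geometry.Lorentzian

end
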